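import Summits.Ventures.PercRepro.C041RcPortOCube

/-!
# The states of the O-cube and mine-3's CONJECTURE (INV), as Lean statements (p6, gen 24; C-041.md §10)

Setting of `C041RcPortOCube`.  The STATES of the cube of `O` are the configurations whose bare part is `O` with some
interior blue edges opened (`O ⊆ bare(S) ⊆ O ∪ B(O)`) and whose blue side is admissible (no zone attached to both
terminals, the zone of the probe not attached): `IsCubeState O S`, `cubeStateSet O`.  A state is INVALID when the probe is
not red-joined to both terminals (with the edges between the terminals red this is «no red terminal edge lands in
`K`»); `ρ_t` = the vertex `u″` is red-reachable from `c` avoiding the blue cluster of `t`; `G_t` = `Good_t`.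
mine-3's CONJECTURE (INV) — for every vertex `u″` of `K(O)` carrying no terminal edge and every side,
`#{states : ¬G_t ∧ ρ_t} ≥ #{invalid states}` — is the Prop `INVConj`.  Nothing is proved here beyond the
definitions: (INV) is the open counting statement of ROW C-041 (C-041.md §10 (d)–(e)); its census there is 0
violations on 1,829 `(O, H)` instances.
-/

namespace PercRepro

namespace MultiGraph

open Finset ZonePort

variable {V E : Type*} {G : MultiGraph V E}

section INV

variable [Fintype V] [Fintype E] [DecidableEq E] (a b c : V)

/-- A state of the cube of `O`: the bare part contains `O` and opens only interior blue edges of `O`; the blue side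
is admissible. -/
def IsCubeState (G : MultiGraph V E) (a b c : V) (O S : Config E) : Prop :=
  (∀ e, G.Bare a b e → O e = true → S e = true) ∧
    (∀ e, G.Bare a b e → O e = false → S e = true → G.InteriorBlue a b O e) ∧
    (¬ G.Conn Sᶜ c a ∧ ¬ G.Conn Sᶜ c b ∧ ¬ G.Conn Sᶜ a b)

open Classical in
/-- The states of the cube of `O`, as a finite set. -/
noncomputable def cubeStateSet (G : MultiGraph V E) (a b c : V) (O : Config E) : Finset (Config E) :=
  univ.filter fun S : Config E => G.IsCubeState a b c O S

/-- An invalid state: the probe is not red-joined to both terminals. -/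
def RcInvalid (G : MultiGraph V E) (a b c : V) (S : Config E) : Prop := ¬ (G.Conn S c a ∧ G.Conn S c b)

/-- `ρ_a(S, u)`: `u` is red-reachable from the probe avoiding the blue cluster of `a`. -/
def RhoA (G : MultiGraph V E) (a c : V) (S : Config E) (u : V) : Prop :=
  G.WalkAvoiding S (G.cluster Sᶜ a) c u

/-- `ρ_b(S, u)`: `u` is red-reachable from the probe avoiding the blue cluster of `b`. -/
def RhoB (G : MultiGraph V E) (b c : V) (S : Config E) (u : V) : Prop :=
  G.WalkAvoiding S (G.cluster Sᶜ b) c u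

open Classical in
/-- `I(O)`: the number of invalid states. -/
noncomputable def invalidCount (G : MultiGraph V E) (a b c : V) (O : Config E) : ℕ :=
  ((G.cubeStateSet a b c O).filter fun S => G.RcInvalid a b c S).card

open Classical in
/-- `m_a(u)`: the states with `¬Good_a` in which `u` is reached on side `a`. -/
noncomputable def mCountA (G : MultiGraph V E) (a b c : V) (O : Config E) (u : V) : ℕ :=
  ((G.cubeStateSet a b c O).filter fun S => ¬ G.WalkAvoiding S (G.cluster Sᶜ a) c b ∧ G.RhoA a c S u).card

open Classical in
/-- `m_b(u)`: the states with `¬Good_b` in which `u` is reached on side `b`. -/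
noncomputable def mCountB (G : MultiGraph V E) (a b c : V) (O : Config E) (u : V) : ℕ :=
  ((G.cubeStateSet a b c O).filter fun S => ¬ G.WalkAvoiding S (G.cluster Sᶜ b) c a ∧ G.RhoB b c S u).card

/-- **mine-3's CONJECTURE (INV)** (C-041.md §10): for every bare colouring `O` and every vertex `u` of `K(O)`
carrying no terminal edge, `m_a(u) ≥ I(O)` and `m_b(u) ≥ I(O)`. -/
def INVConj (G : MultiGraph V E) (a b c : V) : Prop :=
  ∀ (O : Config E) (u : V), u ∈ G.BareReach a b c O → (¬ ∃ e, G.Joins e u a ∨ G.Joins e u b) →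
    G.invalidCount a b c O ≤ G.mCountA a b c O u ∧ G.invalidCount a b c O ≤ G.mCountB a b c O u

omit [Fintype V] [Fintype E] [DecidableEq E] in
/-- A state with the probe red-joined to both terminals is a source with bare colouring `O ∪ X` (its own bare part);
in particular the states of the singleton term `X = ∅` are the sources of `O`. -/
theorem isSrcO_of_state {O S : Config E} (hS : G.IsCubeState a b c O S) (hvalid : G.Conn S c a ∧ G.Conn S c b)
    (hX : ∀ e, G.Bare a b e → S e = O e) : G.IsSrcO a b c O S :=
  ⟨hX, hvalid, hS.2.2⟩

end INV

end MultiGraph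

end PercRepro
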